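import Summits.ABC.IUTFork.Cor312GluedMonoidsNaive
import Summits.ABC.IUTFork.Cor312GluedMonoidsReading3Witness
import Summits.ABC.IUTFork.Cor312PinnedCountermodel
import Summits.ABC.IUTFork.Cor312SharpNotBInput
import HarnessLib

/-!
# Companion of `Cor312GluedMonoidsReading3` §6: what the SEMI-form (⊆) glues force — per-packet volume transport at EVERY `m`

Proof-only file (D-0012; abc-iut cell, wave 5, seat abc-iut-w5-d230; 0 defs, no `Prop` fact). TAKES NO SIDE on [IUTchIII]
Cor. 3.12. It lands, in the tree, the kernel note (K1) of abc-iut-w4-d033's RQ7 audit of p416890/p416559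
(HOME/staging/w4/w4-d033/audit/AUDIT-p416890-p416559.md, ProbeP416890.lean §AuditW4d033, OFFERED to this seat as a «§7» of
`Cor312GluedMonoids*` 2026-08-26T02:04Z / 03:50:34Z) — §§1–2 below are adapted from that probe (credit: abc-iut-w4-d033) and extended
from the single lattice position `m = 0` to EVERY `m`; §§3–5 are new.

CONTEXT. `Cor312GluedMonoidsReading3` §6 (p416890) derives the printed Statement of Cor. 3.12 from Theorem 3.11 AS TYPED plus three
CONTAINMENTS — (hρ⊆) semi-equivariance of the region-forming operator `ρ` under ⟨(Ind1) ∪ (Ind2)⟩, (b1⊆) `ρ(Kummer image of the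
Frobenius-like splitting monoid of (n,m)) ⊆ Θ-region at (n,m)` (so (Ind3) — "upper semi-compatible", [IUTchIII] Thm. 3.11 (ii),
kurims `paper:url-4b091feeb646` p. 156 l. 33–34 — is free to ENLARGE the Θ-regions), (b2⊆) `q-region ⊆ ρ(splitting monoid of a
possible image D′ ∈ ^{n,∘}R^LGP)` — via READING R2 (q-region ⊆ hull). Its EQUALITY-form sibling `Cor312GluedMonoidsCollapse` (p416714)
shows the (=)-glues force EQUAL q/Θ packet log-volumes. THIS file records what the (⊆)-glues cost:

* §1 `qRegion_subset_image_thetaRegion_of_gluedMonoids_le` — SET LEVEL: under Thm. 3.11 (ii) (b) for column `n` the three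
  containments put the q-pilot region inside ONE ⟨Ind1∪Ind2⟩-translate `Φ '' thetaRegion m` of the Θ-pilot region AT EVERY SINGLE
  lattice position `m` (the Frobenius-like splitting monoid of `(n,m)` is the vertically coric one for every `m`) — the
  (Ind3)-union `⋃ₘ` is never visited: (Ind3)'s enlargement does no work in the derivation.
* §2 `qLocal_le_logvol_thetaRegion_of_gluedMonoids_le` — VOLUME LEVEL: at a packet `(j, v_ℚ)`, `j ∈ 𝔽_l^⋇`, where the
  mono-analytic log-volume is invariant under ⟨Ind1∪Ind2⟩ (abc-iut-c312-1's `LatticeSituation.LogvolIndInvariant`, the property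
  [IUTchIV] Thm. 1.10 Step (v) uses and instantiations PROVE), the Θ-region at `(n,m)` and the q-region are admissible and the
  log-volume is monotone between admissible regions, `qLocal j v_ℚ ≤ logvol (thetaRegion m j v_ℚ)` — for every `m`.
* §3 `volumeTransportAt_of_gluedMonoids_le` — PACKAGED over the labels `j = i+1 ∈ 𝔽_l^⋇`: the (⊆)-glues + those side conditions
  yield TEAM B's uniform per-packet input `Cor312Vol.VolumeTransportAt P m₀` (abc-iut-c312-11, p413249 `Cor312LogKummerRoute`) at
  EVERY `m₀`, hence `VolumeTransport P` and — a second derivation of §6's conclusion, this time THROUGH the per-packet B-input —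
  the printed `Statement` (`statement_of_volumeTransport`). So the semi-form gluing reading lands inside the per-packet family of
  plan/ADJUDICATION-SPEC §2 (G1′) (STRONGER-THAN-PRINT per packet), exactly as the (=)-form did.
* §4 `not_qGlue_le_of_packet_lt` / `not_qGlue_le_of_not_volumeTransportAt` — CONTRAPOSITIVES on the decls GAP row G-c312-11-1
  nominates: wherever one packet carries the strict separation `∀ m, logvol (thetaRegion m) < qLocal` of `Cor312SharpNotBInput`
  (p-id of record there) together with the packet-local side conditions — or wherever some `VolumeTransportAt m₀` fails under the
  global ones — NO datum `D′ ∈ ^{n,∘}R^LGP` supplies the q-containment (b2⊆) for a `ρ` satisfying (hρ⊆), (b1⊆): the semi-form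
  glue hypotheses are jointly unsatisfiable there.
* §5 INSTANCES (toy/interface level): (a) at the PINNED COUNTERMODEL OF RECORD `PinnedWitness.pinnedSetting p` (abc-iut-w4-d101,
  p419465/p419720; typed Thm. 3.11 holds, every bridge hypothesis holds, `VolumeTransport` fails) every side condition of §§3–4 is a
  theorem, so `pinnedSetting_not_qGlue_le`: for EVERY semi-equivariant `ρ` satisfying (b1⊆) there, no possible image supplies (b2⊆);
  (b) the hypotheses of §3 are JOINTLY SATISFIABLE (this seat's `glueFull` / abc-iut-c312-6's `toySettingNE`, p416381), so §3 is
  not about the empty set of instances (`volumeTransportAt_glueFull_toySettingNE`).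

READING for the (B) sentence (neutral): relaxing the gluing identities to containments, as print's (Ind3) allows, does not move the
derivation off the per-packet transport family; where that family fails at a packet carrying the side conditions (every honest
`q` versus `q^{j²}` instantiation of the cell), it is the q-containment (b2⊆) — the region-level reading of the Θ×μ_LGP-link gluing
of Step (xi-a), p. 181 l. 36–41 — that fails. Nothing here asserts (hρ⊆), (b1⊆), (b2⊆) or any side condition about the intended
situation; typed ≠ proved; no side taken. [claim: Mochizuki2012, status: disputed] [cite: ScholzeStix2018, §2.2 pp. 9–10]
-/

noncomputable section

open Set

namespace Summit.ABC.IUTFork.Cor312Vol.GluedMonoids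

open Thm311 Cor312 Literature.IUT.LogThetaLattice

variable {T : ThetaIndex}

/-! ## 1. Set level: the q-region inside ONE indeterminacy-translate of the Θ-region, at every `m`
(adapted from HOME/staging/w4/w4-d033/audit/ProbeP416890.lean, `AuditW4d033.qRegion_subset_image_thetaRegion_zero_of_gluedMonoids_le`) -/

section SetLevel

variable (S : LatticeSituation T) (P : Cor312.Setting S.toSituation)
  (ρ : (∀ v : T.V, v ∈ T.Vbad → Set (S.L.StarPacket v)) → ∀ (j : T.Label) (vQ : T.VQ), Set (S.L.Packet j vQ))

/-- **SET LEVEL (abc-iut-w4-d033's K1, at every `m`).** Under the semi-equivariance (hρ⊆), Thm. 3.11 (ii) (b) for column `n`, the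
lower bound (b1⊆) and the upper bound (b2⊆) to the splitting monoid of some `D′ ∈ ^{n,∘}R^LGP`, there is ONE `Φ ∈ ⟨(Ind1) ∪ (Ind2)⟩`
with `qRegion j v_ℚ ⊆ Φ '' thetaRegion m j v_ℚ` for ALL `m, j, v_ℚ`: the q-pilot region sits inside a single indeterminacy-translate of
the Θ-pilot region at every single lattice position — the (Ind3)-union is never visited. (`D′.Ψ = Φ·(^{n,∘}Ψ)`; (ii) (b): the
Frobenius-like splitting monoid of `(n,m)` is `^{n,∘}Ψ` for every `m`.) [claim: Mochizuki2012, status: disputed] -/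
theorem qRegion_subset_image_thetaRegion_of_gluedMonoids_le
    (hρ : ∀ Φ ∈ Subgroup.closure (S.L.Ind1Family ∪ S.L.Ind2Family),
      ∀ (Ψ : ∀ v : T.V, v ∈ T.Vbad → Set (S.L.StarPacket v)) (j : T.Label) (vQ : T.VQ),
        ρ (fun v hv => S.L.starAut Φ v '' Ψ v hv) j vQ ⊆ Φ j vQ '' ρ Ψ j vQ)
    (hKumB : (S.col P.n).KummerB (S.D P.n))
    (hb1 : ∀ (m : ℤ) (j : T.Label) (vQ : T.VQ), ρ ((S.col P.n).frobΨ m) j vQ ⊆ P.thetaRegion m j vQ)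
    {D' : MRData S.L} (hD' : D' ∈ S.RLGP P.n)
    (hb2 : ∀ (j : T.Label) (vQ : T.VQ), P.qRegion j vQ ⊆ ρ D'.Ψ j vQ) :
    ∃ Φ ∈ Subgroup.closure (S.L.Ind1Family ∪ S.L.Ind2Family),
      ∀ (m : ℤ) (j : T.Label) (vQ : T.VQ), P.qRegion j vQ ⊆ Φ j vQ '' P.thetaRegion m j vQ := by
  obtain ⟨Φ, hΦ, hΨ⟩ := exists_closure_psi_eq_of_mem_RLGP (L := S.L) hD'
  refine ⟨Φ, hΦ, fun m j vQ => ?_⟩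
  have hD'Ψ : D'.Ψ = fun v hv => S.L.starAut Φ v '' (S.D P.n).Ψ v hv := funext fun v => funext fun hv => hΨ v hv
  have hfrob : (S.col P.n).frobΨ m = (S.D P.n).Ψ := funext fun v => funext fun hv => hKumB m v hv
  have hm : ρ (S.D P.n).Ψ j vQ ⊆ P.thetaRegion m j vQ := by rw [← hfrob]; exact hb1 m j vQ
  calc P.qRegion j vQ ⊆ ρ D'.Ψ j vQ := hb2 j vQ
    _ = ρ (fun v hv => S.L.starAut Φ v '' (S.D P.n).Ψ v hv) j vQ := by rw [hD'Ψ]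
    _ ⊆ Φ j vQ '' ρ (S.D P.n).Ψ j vQ := hρ Φ hΦ _ j vQ
    _ ⊆ Φ j vQ '' P.thetaRegion m j vQ := Set.image_mono hm

/-- The single-position form at the (xi-a) gluing position `m = 0` (abc-iut-w4-d033's K1 verbatim). [claim: Mochizuki2012, status: disputed] -/
theorem qRegion_subset_image_thetaRegion_zero_of_gluedMonoids_le
    (hρ : ∀ Φ ∈ Subgroup.closure (S.L.Ind1Family ∪ S.L.Ind2Family),
      ∀ (Ψ : ∀ v : T.V, v ∈ T.Vbad → Set (S.L.StarPacket v)) (j : T.Label) (vQ : T.VQ),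
        ρ (fun v hv => S.L.starAut Φ v '' Ψ v hv) j vQ ⊆ Φ j vQ '' ρ Ψ j vQ)
    (hKumB : (S.col P.n).KummerB (S.D P.n))
    (hb1 : ∀ (m : ℤ) (j : T.Label) (vQ : T.VQ), ρ ((S.col P.n).frobΨ m) j vQ ⊆ P.thetaRegion m j vQ)
    {D' : MRData S.L} (hD' : D' ∈ S.RLGP P.n)
    (hb2 : ∀ (j : T.Label) (vQ : T.VQ), P.qRegion j vQ ⊆ ρ D'.Ψ j vQ) (j : T.Label) (vQ : T.VQ) :
    ∃ Φ ∈ Subgroup.closure (S.L.Ind1Family ∪ S.L.Ind2Family), P.qRegion j vQ ⊆ Φ j vQ '' P.thetaRegion 0 j vQ := by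
  obtain ⟨Φ, hΦ, h⟩ := qRegion_subset_image_thetaRegion_of_gluedMonoids_le S P ρ hρ hKumB hb1 hD' hb2
  exact ⟨Φ, hΦ, h 0 j vQ⟩

/-! ## 2. Volume level at one packet (adapted from abc-iut-w4-d033's `AuditW4d033.qLocal_le_logvol_thetaRegion_zero_of_gluedMonoids_le`) -/

/-- **VOLUME LEVEL at a packet `(j, v_ℚ)`, `j ∈ 𝔽_l^⋇`, at every `m`.** Add to §1: invariance of admissibility and log-volume under
⟨(Ind1) ∪ (Ind2)⟩ at `(j, v_ℚ)` (abc-iut-c312-1's `LogvolIndInvariant`), admissibility of the Θ-region at `(n,m)` and of the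
q-region, and monotonicity of the log-volume between admissible regions of that packet. Then the local q-pilot contribution is at
most the log-volume of the `(n,m)`-Kummer image of the Θ-pilot object: `qLocal j v_ℚ ≤ logvol (thetaRegion m j v_ℚ)` — the
`(j, v_ℚ)`-component of TEAM B's `VolumeTransportAt P m`. [claim: Mochizuki2012, status: disputed] -/
theorem qLocal_le_logvol_thetaRegion_of_gluedMonoids_le
    (hρ : ∀ Φ ∈ Subgroup.closure (S.L.Ind1Family ∪ S.L.Ind2Family),
      ∀ (Ψ : ∀ v : T.V, v ∈ T.Vbad → Set (S.L.StarPacket v)) (j : T.Label) (vQ : T.VQ),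
        ρ (fun v hv => S.L.starAut Φ v '' Ψ v hv) j vQ ⊆ Φ j vQ '' ρ Ψ j vQ)
    (hKumB : (S.col P.n).KummerB (S.D P.n))
    (hb1 : ∀ (m : ℤ) (j : T.Label) (vQ : T.VQ), ρ ((S.col P.n).frobΨ m) j vQ ⊆ P.thetaRegion m j vQ)
    {D' : MRData S.L} (hD' : D' ∈ S.RLGP P.n)
    (hb2 : ∀ (j : T.Label) (vQ : T.VQ), P.qRegion j vQ ⊆ ρ D'.Ψ j vQ)
    (j : T.LabelStar) (vQ : T.VQ) (hinv : S.LogvolIndInvariant P.n j vQ) (m : ℤ)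
    (hadm : (S.D P.n).Adm j.1 vQ (P.thetaRegion m j.1 vQ)) (hqadm : (S.D P.n).Adm j.1 vQ (P.qRegion j.1 vQ))
    (hmono : ∀ ⦃A B : Set (S.L.Packet j.1 vQ)⦄, (S.D P.n).Adm j.1 vQ A → (S.D P.n).Adm j.1 vQ B → A ⊆ B →
      (S.D P.n).logvol j.1 vQ A ≤ (S.D P.n).logvol j.1 vQ B) :
    P.qLocal j.1 vQ ≤ (S.D P.n).logvol j.1 vQ (P.thetaRegion m j.1 vQ) := by
  obtain ⟨Φ, hΦ, hsub⟩ := qRegion_subset_image_thetaRegion_of_gluedMonoids_le S P ρ hρ hKumB hb1 hD' hb2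
  obtain ⟨hadmΦ, hvolΦ⟩ := hinv Φ hΦ _ hadm
  show (S.D P.n).logvol j.1 vQ (P.qRegion j.1 vQ) ≤ _
  rw [← hvolΦ]
  exact hmono hqadm hadmΦ (hsub m j.1 vQ)

end SetLevel

/-! ## 3. Packaged over `j ∈ 𝔽_l^⋇`: the (⊆)-glues force TEAM B's per-packet input at every lattice position -/

section Packaged

variable (S : LatticeSituation T) (P : Cor312.Setting S.toSituation)
  (ρ : (∀ v : T.V, v ∈ T.Vbad → Set (S.L.StarPacket v)) → ∀ (j : T.Label) (vQ : T.VQ), Set (S.L.Packet j vQ))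

/-- A label `j = i + 1 ∈ 𝔽_l^⋇` as an element of abc-iut-c312-1's `LabelStar`. [folklore] -/
theorem labelSucc_val (i : Fin T.lstar) :
    ((⟨Setting.labelSucc i, Setting.labelSucc_ne_zero i⟩ : T.LabelStar).1) = Setting.labelSucc i := rfl

/-- **The (⊆)-glues force `VolumeTransportAt P m₀` at EVERY `m₀`.** Hypotheses: (hρ⊆), Thm. 3.11 (ii) (b) for column `n`, (b1⊆),
(b2⊆) for some `D′ ∈ ^{n,∘}R^LGP`; side conditions over the labels `j ∈ 𝔽_l^⋇`: ⟨Ind1∪Ind2⟩-invariance of the log-volume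
(`LogvolIndInvariant`), admissible Kummer images (abc-iut-c312-11's `ThetaRegionsAdm`), admissible q-regions, monotone log-volume
(abc-iut-c312-6's `LogvolMono` = `BridgeHyps.mono`). Conclusion: TEAM B's UNIFORM per-packet input (`Cor312LogKummerRoute`) at
every lattice position — the family plan/ADJUDICATION-SPEC §2 (G1′) classes STRONGER-THAN-PRINT per packet. [claim: Mochizuki2012, status: disputed] -/
theorem volumeTransportAt_of_gluedMonoids_le
    (hρ : ∀ Φ ∈ Subgroup.closure (S.L.Ind1Family ∪ S.L.Ind2Family),
      ∀ (Ψ : ∀ v : T.V, v ∈ T.Vbad → Set (S.L.StarPacket v)) (j : T.Label) (vQ : T.VQ),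
        ρ (fun v hv => S.L.starAut Φ v '' Ψ v hv) j vQ ⊆ Φ j vQ '' ρ Ψ j vQ)
    (hKumB : (S.col P.n).KummerB (S.D P.n))
    (hb1 : ∀ (m : ℤ) (j : T.Label) (vQ : T.VQ), ρ ((S.col P.n).frobΨ m) j vQ ⊆ P.thetaRegion m j vQ)
    {D' : MRData S.L} (hD' : D' ∈ S.RLGP P.n)
    (hb2 : ∀ (j : T.Label) (vQ : T.VQ), P.qRegion j vQ ⊆ ρ D'.Ψ j vQ)
    (hinv : ∀ (i : Fin T.lstar) (vQ : T.VQ),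
      S.LogvolIndInvariant P.n ⟨Setting.labelSucc i, Setting.labelSucc_ne_zero i⟩ vQ)
    (hadm : ThetaRegionsAdm P)
    (hq : ∀ (i : Fin T.lstar) (vQ : T.VQ), (S.D P.n).Adm (Setting.labelSucc i) vQ (P.qRegion (Setting.labelSucc i) vQ))
    (hmono : LogvolMono P) (m₀ : ℤ) : VolumeTransportAt P m₀ := fun i vQ =>
  qLocal_le_logvol_thetaRegion_of_gluedMonoids_le S P ρ hρ hKumB hb1 hD' hb2
    ⟨Setting.labelSucc i, Setting.labelSucc_ne_zero i⟩ vQ (hinv i vQ) m₀ (hadm m₀ i vQ) (hq i vQ)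
    (fun _ _ hA hB hAB => hmono i vQ hA hB hAB)

/-- … hence the pointwise form `VolumeTransport P` (through the gluing position `m₀ = 0`). [claim: Mochizuki2012, status: disputed] -/
theorem volumeTransport_of_gluedMonoids_le
    (hρ : ∀ Φ ∈ Subgroup.closure (S.L.Ind1Family ∪ S.L.Ind2Family),
      ∀ (Ψ : ∀ v : T.V, v ∈ T.Vbad → Set (S.L.StarPacket v)) (j : T.Label) (vQ : T.VQ),
        ρ (fun v hv => S.L.starAut Φ v '' Ψ v hv) j vQ ⊆ Φ j vQ '' ρ Ψ j vQ)
    (hKumB : (S.col P.n).KummerB (S.D P.n))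
    (hb1 : ∀ (m : ℤ) (j : T.Label) (vQ : T.VQ), ρ ((S.col P.n).frobΨ m) j vQ ⊆ P.thetaRegion m j vQ)
    {D' : MRData S.L} (hD' : D' ∈ S.RLGP P.n)
    (hb2 : ∀ (j : T.Label) (vQ : T.VQ), P.qRegion j vQ ⊆ ρ D'.Ψ j vQ)
    (hinv : ∀ (i : Fin T.lstar) (vQ : T.VQ),
      S.LogvolIndInvariant P.n ⟨Setting.labelSucc i, Setting.labelSucc_ne_zero i⟩ vQ)
    (hadm : ThetaRegionsAdm P)
    (hq : ∀ (i : Fin T.lstar) (vQ : T.VQ), (S.D P.n).Adm (Setting.labelSucc i) vQ (P.qRegion (Setting.labelSucc i) vQ))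
    (hmono : LogvolMono P) : VolumeTransport P :=
  volumeTransport_of_at (volumeTransportAt_of_gluedMonoids_le S P ρ hρ hKumB hb1 hD' hb2 hinv hadm hq hmono 0)

/-- **The printed Statement of Cor. 3.12 from the (⊆)-glues THROUGH TEAM B's per-packet input** (a second derivation of
`Cor312GluedMonoidsReading3` §6's conclusion, here via abc-iut-c312-11's `statement_of_volumeTransport` instead of READING R2):
bridge hypotheses + admissible Kummer images + admissible q-regions + ⟨Ind1∪Ind2⟩-invariant log-volumes + (ii)(b) + (hρ⊆), (b1⊆),
(b2⊆) ⟹ `−|log(Θ)| ∈ ℝ` and `−|log(q)| ≤ −|log(Θ)|`. [claim: Mochizuki2012, status: disputed] -/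
theorem statement_of_gluedMonoids_le_via_volumeTransport (H : BridgeHyps P) (hadm : ThetaRegionsAdm P)
    (hq : ∀ (i : Fin T.lstar) (vQ : T.VQ), (S.D P.n).Adm (Setting.labelSucc i) vQ (P.qRegion (Setting.labelSucc i) vQ))
    (hinv : ∀ (i : Fin T.lstar) (vQ : T.VQ),
      S.LogvolIndInvariant P.n ⟨Setting.labelSucc i, Setting.labelSucc_ne_zero i⟩ vQ)
    (hρ : ∀ Φ ∈ Subgroup.closure (S.L.Ind1Family ∪ S.L.Ind2Family),
      ∀ (Ψ : ∀ v : T.V, v ∈ T.Vbad → Set (S.L.StarPacket v)) (j : T.Label) (vQ : T.VQ),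
        ρ (fun v hv => S.L.starAut Φ v '' Ψ v hv) j vQ ⊆ Φ j vQ '' ρ Ψ j vQ)
    (hKumB : (S.col P.n).KummerB (S.D P.n))
    (hb1 : ∀ (m : ℤ) (j : T.Label) (vQ : T.VQ), ρ ((S.col P.n).frobΨ m) j vQ ⊆ P.thetaRegion m j vQ)
    {D' : MRData S.L} (hD' : D' ∈ S.RLGP P.n)
    (hb2 : ∀ (j : T.Label) (vQ : T.VQ), P.qRegion j vQ ⊆ ρ D'.Ψ j vQ) : P.Statement :=
  statement_of_volumeTransport P H hadm
    (volumeTransport_of_gluedMonoids_le S P ρ hρ hKumB hb1 hD' hb2 hinv hadm hq H.mono)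

end Packaged

/-! ## 4. Contrapositives: where the per-packet input fails, the q-containment (b2⊆) is unsatisfiable -/

section Contrapositive

variable (S : LatticeSituation T) (P : Cor312.Setting S.toSituation)
  (ρ : (∀ v : T.V, v ∈ T.Vbad → Set (S.L.StarPacket v)) → ∀ (j : T.Label) (vQ : T.VQ), Set (S.L.Packet j vQ))

/-- **Packet-local contrapositive.** If at ONE packet `(j = i+1, v_ℚ)` every single Kummer image of the Θ-pilot object has
log-volume strictly BELOW the q-pilot contribution (the separation hypothesis of abc-iut-c312-11's `Cor312SharpNotBInput`, carried
by the cell's honest `q` versus `q^{j²}` settings), and that packet carries the side conditions of §2 at `m = 0` (invariant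
log-volume, admissible Θ-region at `(n,0)` and q-region, local monotonicity), then under (ii)(b), (hρ⊆) and (b1⊆) NO possible image
`D′ ∈ ^{n,∘}R^LGP` supplies the q-containment (b2⊆) — while the same separation leaves every uniform `VolumeTransportAt P m₀`
false (abc-iut-c312-11's `Cor312Vol.not_volumeTransportAt_of_packet_lt`): both consequences of the separation, side by side.
[claim: Mochizuki2012, status: disputed] -/
theorem not_qGlue_le_of_packet_lt
    (hρ : ∀ Φ ∈ Subgroup.closure (S.L.Ind1Family ∪ S.L.Ind2Family),
      ∀ (Ψ : ∀ v : T.V, v ∈ T.Vbad → Set (S.L.StarPacket v)) (j : T.Label) (vQ : T.VQ),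
        ρ (fun v hv => S.L.starAut Φ v '' Ψ v hv) j vQ ⊆ Φ j vQ '' ρ Ψ j vQ)
    (hKumB : (S.col P.n).KummerB (S.D P.n))
    (hb1 : ∀ (m : ℤ) (j : T.Label) (vQ : T.VQ), ρ ((S.col P.n).frobΨ m) j vQ ⊆ P.thetaRegion m j vQ)
    (i : Fin T.lstar) (vQ : T.VQ)
    (hinv : S.LogvolIndInvariant P.n ⟨Setting.labelSucc i, Setting.labelSucc_ne_zero i⟩ vQ)
    (hadm : (S.D P.n).Adm (Setting.labelSucc i) vQ (P.thetaRegion 0 (Setting.labelSucc i) vQ))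
    (hqadm : (S.D P.n).Adm (Setting.labelSucc i) vQ (P.qRegion (Setting.labelSucc i) vQ))
    (hmono : ∀ ⦃A B : Set (S.L.Packet (Setting.labelSucc i) vQ)⦄, (S.D P.n).Adm _ vQ A → (S.D P.n).Adm _ vQ B →
      A ⊆ B → (S.D P.n).logvol _ vQ A ≤ (S.D P.n).logvol _ vQ B)
    (hlt : ∀ m : ℤ, (S.D P.n).logvol (Setting.labelSucc i) vQ (P.thetaRegion m (Setting.labelSucc i) vQ) <
      P.qLocal (Setting.labelSucc i) vQ) :
    ¬ ∃ D' ∈ S.RLGP P.n, ∀ (j : T.Label) (vQ : T.VQ), P.qRegion j vQ ⊆ ρ D'.Ψ j vQ := by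
  rintro ⟨D', hD', hb2⟩
  exact absurd
    (qLocal_le_logvol_thetaRegion_of_gluedMonoids_le S P ρ hρ hKumB hb1 hD' hb2
      ⟨Setting.labelSucc i, Setting.labelSucc_ne_zero i⟩ vQ hinv 0 hadm hqadm hmono)
    (not_le.2 (hlt 0))

/-- **Global contrapositive.** Under the global side conditions of §3 (invariant log-volumes, admissible Kummer images and
q-regions at the labels `𝔽_l^⋇`, monotone log-volume), (ii)(b), (hρ⊆) and (b1⊆): if TEAM B's uniform input `VolumeTransportAt P m₀`
FAILS at some `m₀`, then no possible image supplies the q-containment (b2⊆). [claim: Mochizuki2012, status: disputed] -/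
theorem not_qGlue_le_of_not_volumeTransportAt
    (hρ : ∀ Φ ∈ Subgroup.closure (S.L.Ind1Family ∪ S.L.Ind2Family),
      ∀ (Ψ : ∀ v : T.V, v ∈ T.Vbad → Set (S.L.StarPacket v)) (j : T.Label) (vQ : T.VQ),
        ρ (fun v hv => S.L.starAut Φ v '' Ψ v hv) j vQ ⊆ Φ j vQ '' ρ Ψ j vQ)
    (hKumB : (S.col P.n).KummerB (S.D P.n))
    (hb1 : ∀ (m : ℤ) (j : T.Label) (vQ : T.VQ), ρ ((S.col P.n).frobΨ m) j vQ ⊆ P.thetaRegion m j vQ)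
    (hinv : ∀ (i : Fin T.lstar) (vQ : T.VQ),
      S.LogvolIndInvariant P.n ⟨Setting.labelSucc i, Setting.labelSucc_ne_zero i⟩ vQ)
    (hadm : ThetaRegionsAdm P)
    (hq : ∀ (i : Fin T.lstar) (vQ : T.VQ), (S.D P.n).Adm (Setting.labelSucc i) vQ (P.qRegion (Setting.labelSucc i) vQ))
    (hmono : LogvolMono P) {m₀ : ℤ} (hfail : ¬ VolumeTransportAt P m₀) :
    ¬ ∃ D' ∈ S.RLGP P.n, ∀ (j : T.Label) (vQ : T.VQ), P.qRegion j vQ ⊆ ρ D'.Ψ j vQ := by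
  rintro ⟨D', hD', hb2⟩
  exact hfail (volumeTransportAt_of_gluedMonoids_le S P ρ hρ hKumB hb1 hD' hb2 hinv hadm hq hmono m₀)

/-- … in particular under `¬ VolumeTransport P` (which refutes every uniform form). [claim: Mochizuki2012, status: disputed] -/
theorem not_qGlue_le_of_not_volumeTransport
    (hρ : ∀ Φ ∈ Subgroup.closure (S.L.Ind1Family ∪ S.L.Ind2Family),
      ∀ (Ψ : ∀ v : T.V, v ∈ T.Vbad → Set (S.L.StarPacket v)) (j : T.Label) (vQ : T.VQ),
        ρ (fun v hv => S.L.starAut Φ v '' Ψ v hv) j vQ ⊆ Φ j vQ '' ρ Ψ j vQ)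
    (hKumB : (S.col P.n).KummerB (S.D P.n))
    (hb1 : ∀ (m : ℤ) (j : T.Label) (vQ : T.VQ), ρ ((S.col P.n).frobΨ m) j vQ ⊆ P.thetaRegion m j vQ)
    (hinv : ∀ (i : Fin T.lstar) (vQ : T.VQ),
      S.LogvolIndInvariant P.n ⟨Setting.labelSucc i, Setting.labelSucc_ne_zero i⟩ vQ)
    (hadm : ThetaRegionsAdm P)
    (hq : ∀ (i : Fin T.lstar) (vQ : T.VQ), (S.D P.n).Adm (Setting.labelSucc i) vQ (P.qRegion (Setting.labelSucc i) vQ))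
    (hmono : LogvolMono P) (hfail : ¬ VolumeTransport P) :
    ¬ ∃ D' ∈ S.RLGP P.n, ∀ (j : T.Label) (vQ : T.VQ), P.qRegion j vQ ⊆ ρ D'.Ψ j vQ :=
  not_qGlue_le_of_not_volumeTransportAt S P ρ hρ hKumB hb1 hinv hadm hq hmono (m₀ := 0)
    fun h => hfail (volumeTransport_of_at h)

end Contrapositive

/-! ## 5. Instances (toy / interface level): the pinned countermodel of record; joint satisfiability of §3 -/

namespace SemiTransport

open Cor312.Checks Cor312.IdentifiedNonVacuity NaiveWitness PinnedWitness

section Pinned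

variable (p : ℕ) [hp : Fact p.Prime]

/-- At the pinned countermodel of record every uniform per-packet input fails (from abc-iut-w4-d101's
`pinnedSetting_not_volumeTransport`, p419720). [folklore] -/
theorem pinnedSetting_not_volumeTransportAt (m₀ : ℤ) : ¬ VolumeTransportAt (pinnedSetting p) m₀ :=
  fun h => pinnedSetting_not_volumeTransport p (volumeTransport_of_at h)

omit hp in
/-- At the pinned countermodel the q-pilot image at a label of `𝔽_l^⋇` is admissible (it is the ball `B_1`). [folklore] -/
theorem pinnedSetting_qRegion_adm (i : Fin Cor312.Checks.toyIndex.lstar) (vQ : Cor312.Checks.toyIndex.VQ) :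
    ((naiveFull p).D (pinnedSetting p).n).Adm (Setting.labelSucc i) vQ ((pinnedSetting p).qRegion (Setting.labelSucc i) vQ) :=
  ⟨1, pinnedSetting_qRegion_of_ne_zero p (Setting.labelSucc_ne_zero i) vQ⟩

/-- **At the PINNED COUNTERMODEL OF RECORD the semi-form q-containment is unsatisfiable for EVERY admissible `ρ`.** Over
abc-iut-w5-d247's contentful naive situation `naiveFull p` (typed Thm. 3.11 holds; ⟨Ind1∪Ind2⟩ acts by signs, so log-volumes are
invariant — this seat's `naive_logvolIndInvariant`) at abc-iut-w4-d101's `pinnedSetting p` (every bridge hypothesis; admissible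
Kummer images; `VolumeTransport` FAILS): for every region-forming operator `ρ` that is semi-equivariant (hρ⊆) and satisfies the
Θ-lower bound (b1⊆), NO possible image `D′ ∈ ^{0,∘}R^LGP` has `qRegion ⊆ ρ D′.Ψ` everywhere. All side conditions of §4 are theorems
here, so the contrapositive is not about the empty set of instances. Interface/toy level. [claim: Mochizuki2012, status: disputed] -/
theorem pinnedSetting_not_qGlue_le
    (ρ : (∀ v : Cor312.Checks.toyIndex.V, v ∈ Cor312.Checks.toyIndex.Vbad → Set (signShells.StarPacket v)) →
      ∀ (j : Cor312.Checks.toyIndex.Label) (vQ : Cor312.Checks.toyIndex.VQ), Set (signShells.Packet j vQ))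
    (hρ : ∀ Φ ∈ Subgroup.closure (signShells.Ind1Family ∪ signShells.Ind2Family),
      ∀ (Ψ : ∀ v : Cor312.Checks.toyIndex.V, v ∈ Cor312.Checks.toyIndex.Vbad → Set (signShells.StarPacket v)) (j : Cor312.Checks.toyIndex.Label) (vQ : Cor312.Checks.toyIndex.VQ),
        ρ (fun v hv => signShells.starAut Φ v '' Ψ v hv) j vQ ⊆ Φ j vQ '' ρ Ψ j vQ)
    (hb1 : ∀ (m : ℤ) (j : Cor312.Checks.toyIndex.Label) (vQ : Cor312.Checks.toyIndex.VQ),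
      ρ (((naiveFull p).col (pinnedSetting p).n).frobΨ m) j vQ ⊆ (pinnedSetting p).thetaRegion m j vQ) :
    ¬ ∃ D' ∈ (naiveFull p).RLGP (pinnedSetting p).n,
      ∀ (j : Cor312.Checks.toyIndex.Label) (vQ : Cor312.Checks.toyIndex.VQ), (pinnedSetting p).qRegion j vQ ⊆ ρ D'.Ψ j vQ :=
  not_qGlue_le_of_not_volumeTransport (naiveFull p).toLatticeSituation (pinnedSetting p) ρ hρ (Naive.naive_kummerB p _) hb1
    (fun _ vQ => Naive.naive_logvolIndInvariant p _ _ vQ) (pinnedSetting_thetaRegionsAdm p) (pinnedSetting_qRegion_adm p)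
    (pinnedSetting_bridgeHyps p).mono (pinnedSetting_not_volumeTransport p)

/-- The same at the (xi-a)-natural operator of record, abc-iut-w4-d101's `orbitRegion p` (`Ψ ↦ Ψ_j·𝒪`; equivariant WITH EQUALITY —
`orbitRegion_equivariant` — and glued to the Θ-side EXACTLY, so (hρ⊆)/(b1⊆) hold a fortiori): no possible image supplies even the
CONTAINMENT `qRegion ⊆ orbitRegion D′.Ψ`. [claim: Mochizuki2012, status: disputed] -/
theorem pinnedSetting_not_qGlue_le_orbitRegion :
    ¬ ∃ D' ∈ (naiveFull p).RLGP (pinnedSetting p).n,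
      ∀ (j : Cor312.Checks.toyIndex.Label) (vQ : Cor312.Checks.toyIndex.VQ), (pinnedSetting p).qRegion j vQ ⊆ orbitRegion p D'.Ψ j vQ := by
  refine pinnedSetting_not_qGlue_le p (orbitRegion p) (fun Φ hΦ Ψ j vQ => (orbitRegion_equivariant p hΦ Ψ j vQ).subset)
    fun m j vQ => ?_
  have hΨ : ((naiveFull p).col (pinnedSetting p).n).frobΨ m = ((naiveFull p).D (pinnedSetting p).n).Ψ :=
    funext fun v => funext fun hv => Naive.naive_kummerB p _ m v hv
  have hD : ((naiveFull p).D (pinnedSetting p).n).Ψ = fun v _ => Psi p v := rfl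
  rw [hΨ, hD, orbitRegion_Psi, pinnedSetting_thetaRegion]

end Pinned

section Satisfiable

/-- The toy data of abc-iut-c312-7's `toyData 0` give every region log-volume `0`. [folklore] -/
theorem toyData_zero_logvol (j : Cor312.Checks.toyIndex.Label) (vQ : Cor312.Checks.toyIndex.VQ) (A : Set (Cor312.Checks.toyShells.Packet j vQ)) :
    (Cor312.Checks.toyData 0).logvol j vQ A = 0 := by
  show (if A = ∅ then (0 : ℝ) else 0) = 0
  split_ifs <;> rfl

/-- ⟨Ind1∪Ind2⟩-invariance of the log-volume holds in this seat's toy full situation `glueFull` (p416381): everything is admissible and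
every log-volume is `0`. [folklore] -/
theorem glueFull_logvolIndInvariant (n : ℤ) (j : Cor312.Checks.toyIndex.LabelStar) (vQ : Cor312.Checks.toyIndex.VQ) :
    glueFull.LogvolIndInvariant n j vQ := fun Φ _ A _ =>
  ⟨trivial, by
    show (Cor312.Checks.toyData 0).logvol j.1 vQ (Φ j.1 vQ '' A) = (Cor312.Checks.toyData 0).logvol j.1 vQ A
    rw [toyData_zero_logvol, toyData_zero_logvol]⟩

/-- **JOINT SATISFIABILITY of the hypotheses of §3** (so `volumeTransportAt_of_gluedMonoids_le` is not a statement about the empty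
set of instances): at `glueFull` / abc-iut-c312-6's nonempty toy `toySettingNE` with the constant operator `Set.univ` (this seat's
witness of record, p416381) and `D′ :=` the line-`0` datum, (hρ⊆), (ii)(b), (b1⊆), (b2⊆), invariant log-volumes, admissible regions
and monotone log-volume ALL hold — and §3 returns `VolumeTransportAt _ m₀` at every `m₀`. Toy level. [folklore] -/
theorem volumeTransportAt_glueFull_toySettingNE (m₀ : ℤ) :
    VolumeTransportAt (Cor312Vol.Checks.toySettingNE : Cor312.Setting glueFull.toLatticeSituation.toSituation) m₀ :=
  volumeTransportAt_of_gluedMonoids_le glueFull.toLatticeSituation Cor312Vol.Checks.toySettingNE (fun _ _ _ => Set.univ)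
    (fun Φ _ Ψ j vQ => (const_univ_equivariant Φ Ψ j vQ).subset)
    (kummerB_of_statement glueFull glueFull_statement _) (fun _ _ _ => subset_of_eq rfl)
    (glueFull.mem_RLGP_of_multiradialCompat (multiradialCompat_of_statement glueFull glueFull_statement) _ 0)
    (fun _ _ => subset_of_eq rfl) (fun _ vQ => glueFull_logvolIndInvariant _ _ vQ)
    Cor312Vol.Checks.thetaRegionsAdm_toySettingNE (fun _ _ => trivial) Cor312Vol.Checks.bridgeHyps_toySettingNE.mono m₀

end Satisfiable

end SemiTransport

end Summit.ABC.IUTFork.Cor312Vol.GluedMonoids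

end
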